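import Mathlib.RingTheory.Ideal.Maps
import Mathlib.RingTheory.Ideal.Operations
import Mathlib.RingTheory.Ideal.Quotient.Operations
import Mathlib.LinearAlgebra.Pi
import Mathlib.Tactic.FinCases
import Mathlib.Tactic.LinearCombination
import Summits.BirchSwinnertonDyer.Rank1Residual.X4.SaturationDevissage
import Summits.BirchSwinnertonDyer.Rank1Residual.X4.TwoPrimeSupportedIdealSplitting
import Summits.BirchSwinnertonDyer.Rank1Residual.X4.LevelRaisingCongruenceOfOldSupported
import HarnessLib

/-!
# Step (i) of Proposition V58: under multiplicity one the two-prime saturation T-V54 IS the supported-ideal identity (R) — and, with the key identity (K), T-V54 follows (cell `b2b-bsdres`, seat additive-p4 gen 41, line V58/V72 — K121)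

HONEST FRAMING (verbatim, cell `b2b-bsdres`): the goal of the cell is to DELETE the COMBINATION-SHAPED
residual classes for ALL analytic-rank `≤ 1` curves over `ℚ` — "full BSD formula for every rank `≤ 1`
curve in class `C`" assembled STRICTLY from published theorems — so that the rank-`≤ 1` remainder
becomes exactly the CONSTRUCTION-SHAPED classes, which are TYPED (missing-input Props), NOT attempted;
this is not "finishing BSD". This file: PURE MODULE ALGEBRA (0 defs, 0 facts, nothing booked; X4 stays
CONSTRUCTION-shaped; no mark moves).

## Why

Memo V58 (§2, with REFEREE 2's correction F1, §12) proves the two-prime saturation T-V54(𝔪₂) —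
"`O₁ + O₂` is `p`-saturated in `H′ = H₁(X₀(N), ℤ_p)_{𝔪₂}`", `O_i` the `ℓ_i`-old sublattice — in steps:
(i) under MULTIPLICITY ONE T-V54 ⟺ the ring identity (R) `A_{oo∪Z∪W} = A_{oo∪Z} + A_{oo∪W}`;
(R) ⟸ (K) is K107/K113; (K) is K106 (= L1 ∘ L2) on quaternionic multiplicity one and Ribet's `δ`
surjective. K107's docstring records that step (i) "is NOT proved" there. This file proves it and
composes everything into ONE kernel implication with displayed hypotheses (Appendices).

MODEL. As in K113 the newform TYPES enter as ring homomorphisms out of the local Hecke algebra `T`: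
`e₂` (type `Z`, new at `ℓ₂` only), `e₃` (type `W`), `e₄` (type `W′`, new at both); supported ideals
`A_{oo∪Z} = ker e₃ ⊓ ker e₄`, `A_{oo∪W} = ker e₂ ⊓ ker e₄`, `A_{oo∪Z∪W} = ker e₄`, `A_{oo∪W∪W′} = ker e₂`.
(MO_N): `H′ ≅ 𝕋′^ι` (`#ι = 2`), types acting coordinatewise, so `H′` is modelled as `ι → T`; Ihara at `ℓ₁`
(saturated degeneracy image) identifies the `ℓ₁`-old sublattice with `(A_{oo∪Z})^ι`, likewise
`O₂ = (A_{oo∪W})^ι` (`Submodule.pi univ (fun _ ↦ A)`; the lattice fact behind the identification is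
`eq_of_le_of_saturated_of_pow_smul_mem`).

## What is proved

* `eq_of_le_of_saturated_of_pow_smul_mem`, `saturated_iff_eq_of_le` — saturation bookkeeping: for
  `A ≤ B` with `B` `p`-saturated and `B/A` `p`-power torsion, `A` is `p`-saturated iff `A = B`.
* `pi_const_sup_eq`, `pi_const_saturated_iff` — the free-module dictionary: `A^ι + B^ι = (A + B)^ι`
  and `A^ι` is `p`-saturated in `T^ι` iff `A` is `p`-saturated in `T` (`ι` non-empty).
* `twoPrimeSaturated_iff_supported_sup_eq` — **STEP (i)**: with `O₁ := (ker e₃ ⊓ ker e₄)^ι`,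
  `O₂ := (ker e₂ ⊓ ker e₄)^ι`, and given that `ker e₄` is `p`-saturated in `T` (automatic when `p` is
  a non-zero-divisor of `R₄`: `ker_saturated_of_mul_eq_zero_imp`) and that `ker e₄ / (A_{oo∪Z} + A_{oo∪W})`
  is `p`-power torsion (the RATIONAL form of T-V54 — automatic from the decomposition of `𝕋′ ⊗ ℚ` into
  newform components; displayed as `hfin`): `O₁ ⊔ O₂` is `p`-saturated in `ι → T` **iff** (R).
* (Appendix, second landing) `keyIdentity_of_brandtData`, `twoPrimeSaturated_of_brandtData` —
  **PROPOSITION V58 IN KERNEL FORM**: (K) from the Brandt-module data of K106 plus the lift `R[𝒰] ⊆ e₂(T)`,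
  and T-V54 from those data in the multiplicity-one model (all displayed hypotheses listed there).
* (Appendix 2, third landing) `exists_eq_smul_one_add_smul_of_commute_companion` (the centralizer of
  the companion matrix is `R[𝒰]`), `twoPrimeSaturated_of_brandtData'` — the kernel form with `hpoly`
  discharged and `hlift` reduced to `R·1 ⊆ e₂(T)`.
* `twoPrimeSaturated_of_levelRaising` — **(K) ⟹ T-V54** for the free module: K107's hypotheses
  (`η ∈ A_{oo∪Z}`, and every `t ∈ A_{oo∪Z∪W}` is `≡ η·a` modulo `A_{oo∪W∪W′}`) and `ker e₄` saturated
  give the saturation of `O₁ ⊔ O₂` — no finiteness hypothesis is needed in this direction.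

No number theory enters; application: memo V58, THETA-ROWS-ENDSTATE (a′) at the `3`-free level `M`,
TWIST-ROWS-ENDSTATE at `N_V` ((MO) Ribet 1990 Thm 5.2(b) / Wiles 1995 Thm 2.1; Ihara at `ℓ_i` BY NAME; (K)).
References (context only): K. A. Ribet, Invent. Math. 100 (1990), §3, Thm. 5.2 [cite: Ribet1990, §3, Thm. 5.2];
F. Diamond, "The refined conjecture of Serre" (Hong Kong 1993 vol.), §§3–4 [cite: Diamond1995RefinedSerre, §§3–4];
A. Wiles, Ann. of Math. 141 (1995), Thm. 2.1 [cite: Wiles1995, Thm. 2.1].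
-/

namespace Summit.BirchSwinnertonDyer.Rank1Residual.LevelLowering

section Saturation

variable {R M : Type*} [CommRing R] [AddCommGroup M] [Module R M]

/-- A `p`-saturated submodule `A ≤ B` such that `B/A` is `p`-power torsion equals `B`. (The lattice
fact behind "Ihara ⟹ the `ℓ`-old sublattice is `H′ ∩ (old components)`", and behind step (i).) -/
theorem eq_of_le_of_saturated_of_pow_smul_mem (r : R) (A B : Submodule R M) (hAB : A ≤ B)
    (hsat : ∀ x : M, r • x ∈ A → x ∈ A) (hfin : ∀ x ∈ B, ∃ n : ℕ, r ^ n • x ∈ A) : A = B := by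
  refine le_antisymm hAB ?_
  intro x hx
  obtain ⟨n, hn⟩ := hfin x hx
  exact pow_smul_mem_imp_mem r ⊤ A (fun y _ hy => hsat y hy) n x Submodule.mem_top hn

/-- For `A ≤ B` with `B` `p`-saturated and `B/A` `p`-power torsion: `A` is `p`-saturated iff `A = B`. -/
theorem saturated_iff_eq_of_le (r : R) (A B : Submodule R M) (hAB : A ≤ B)
    (hsatB : ∀ x : M, r • x ∈ B → x ∈ B) (hfin : ∀ x ∈ B, ∃ n : ℕ, r ^ n • x ∈ A) :
    (∀ x : M, r • x ∈ A → x ∈ A) ↔ A = B := by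
  constructor
  · intro hsat
    exact eq_of_le_of_saturated_of_pow_smul_mem r A B hAB hsat hfin
  · rintro rfl
    exact hsatB

end Saturation

section FreeModule

variable {R : Type*} [CommRing R] {ι : Type*}

/-- The free-module dictionary, sums: `A^ι + B^ι = (A + B)^ι` inside `ι → R`. -/
theorem pi_const_sup_eq (A B : Ideal R) :
    Submodule.pi Set.univ (fun _ : ι => (A : Submodule R R)) ⊔
        Submodule.pi Set.univ (fun _ : ι => (B : Submodule R R)) =
      Submodule.pi Set.univ (fun _ : ι => ((A ⊔ B : Ideal R) : Submodule R R)) := by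
  apply le_antisymm
  · refine sup_le ?_ ?_
    · exact Submodule.pi_mono fun _ _ => (le_sup_left : A ≤ A ⊔ B)
    · exact Submodule.pi_mono fun _ _ => (le_sup_right : B ≤ A ⊔ B)
  · intro x hx
    rw [Submodule.mem_pi] at hx
    have h : ∀ i : ι, ∃ a ∈ A, ∃ b ∈ B, a + b = x i := fun i =>
      Submodule.mem_sup.mp (hx i (Set.mem_univ i))
    choose a ha b hb hab using h
    have hx' : x = (fun i => a i) + fun i => b i := by
      funext i; simp [hab i]
    rw [hx']
    refine Submodule.add_mem_sup ?_ ?_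
    · exact Submodule.mem_pi.mpr fun i _ => ha i
    · exact Submodule.mem_pi.mpr fun i _ => hb i

/-- The free-module dictionary, saturation: for `ι` non-empty, `A^ι` is `r`-saturated in `ι → R` iff
`A` is `r`-saturated in `R`. -/
theorem pi_const_saturated_iff [Nonempty ι] (r : R) (A : Ideal R) :
    (∀ x : ι → R, r • x ∈ Submodule.pi Set.univ (fun _ : ι => (A : Submodule R R)) →
        x ∈ Submodule.pi Set.univ (fun _ : ι => (A : Submodule R R))) ↔
      ∀ t : R, r * t ∈ A → t ∈ A := by
  constructor
  · intro h t ht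
    obtain ⟨i⟩ := ‹Nonempty ι›
    have hconst : (fun _ : ι => t) ∈ Submodule.pi Set.univ (fun _ : ι => (A : Submodule R R)) := by
      refine h _ (Submodule.mem_pi.mpr fun j _ => ?_)
      simpa [Pi.smul_apply, smul_eq_mul] using ht
    exact (Submodule.mem_pi.mp hconst) i (Set.mem_univ i)
  · intro h x hx
    refine Submodule.mem_pi.mpr fun i _ => h (x i) ?_
    have := (Submodule.mem_pi.mp hx) i (Set.mem_univ i)
    simpa [Pi.smul_apply, smul_eq_mul] using this

/-- One direction without the non-emptiness: if `A` is `r`-saturated in `R` then `A^ι` is `r`-saturated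
in `ι → R`. -/
theorem pi_const_saturated_of_saturated (r : R) (A : Ideal R) (h : ∀ t : R, r * t ∈ A → t ∈ A) :
    ∀ x : ι → R, r • x ∈ Submodule.pi Set.univ (fun _ : ι => (A : Submodule R R)) →
      x ∈ Submodule.pi Set.univ (fun _ : ι => (A : Submodule R R)) := by
  intro x hx
  refine Submodule.mem_pi.mpr fun i _ => h (x i) ?_
  have := (Submodule.mem_pi.mp hx) i (Set.mem_univ i)
  simpa [Pi.smul_apply, smul_eq_mul] using this

end FreeModule

section StepOne

variable {T R₂ R₃ R₄ : Type*} [CommRing T] [CommRing R₂] [CommRing R₃] [CommRing R₄]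

/-- If the image of `p` is a non-zero-divisor of `R₄` then `A_{oo∪Z∪W} = ker e₄` is `p`-saturated in
`T` (the hypothesis `hsat₄` of step (i); in the application `R₄ ⊂ ∏ 𝒪_c` is `ℤ_p`-torsion-free). -/
theorem ker_saturated_of_mul_eq_zero_imp (e₄ : T →+* R₄) (p : T)
    (hp : ∀ y : R₄, e₄ p * y = 0 → y = 0) :
    ∀ t : T, p * t ∈ RingHom.ker e₄ → t ∈ RingHom.ker e₄ := by
  intro t ht
  rw [RingHom.mem_ker] at ht ⊢
  rw [map_mul] at ht
  exact hp _ ht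

/-- **STEP (i) OF PROPOSITION V58 (memo V58 §2): under multiplicity one, T-V54 ⟺ (R).** In the free
module `ι → T` (`ι` non-empty; (MO_N) is `#ι = 2`) put `O₁ := (ker e₃ ⊓ ker e₄)^ι` (the `ℓ₁`-old
sublattice: no `W`, `W′` components — its identification with the degeneracy image is Ihara at `ℓ₁`)
and `O₂ := (ker e₂ ⊓ ker e₄)^ι`. If `ker e₄` is `p`-saturated in `T` and `ker e₄/(A_{oo∪Z} + A_{oo∪W})`
is `p`-power torsion (`hfin`, the rational form of T-V54), then
`O₁ ⊔ O₂` is `p`-saturated ⟺ `(ker e₃ ⊓ ker e₄) ⊔ (ker e₂ ⊓ ker e₄) = ker e₄`.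
[cite: Wiles1995, Thm. 2.1] [cite: Diamond1995RefinedSerre, §§3–4] -/
theorem twoPrimeSaturated_iff_supported_sup_eq {ι : Type*} [Nonempty ι]
    (e₂ : T →+* R₂) (e₃ : T →+* R₃) (e₄ : T →+* R₄) (p : T)
    (hsat₄ : ∀ t : T, p * t ∈ RingHom.ker e₄ → t ∈ RingHom.ker e₄)
    (hfin : ∀ t ∈ RingHom.ker e₄, ∃ n : ℕ,
      p ^ n * t ∈ (RingHom.ker e₃ ⊓ RingHom.ker e₄) ⊔ (RingHom.ker e₂ ⊓ RingHom.ker e₄)) :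
    (∀ x : ι → T,
        p • x ∈ Submodule.pi Set.univ
            (fun _ : ι => ((RingHom.ker e₃ ⊓ RingHom.ker e₄ : Ideal T) : Submodule T T)) ⊔
          Submodule.pi Set.univ
            (fun _ : ι => ((RingHom.ker e₂ ⊓ RingHom.ker e₄ : Ideal T) : Submodule T T)) →
        x ∈ Submodule.pi Set.univ
            (fun _ : ι => ((RingHom.ker e₃ ⊓ RingHom.ker e₄ : Ideal T) : Submodule T T)) ⊔
          Submodule.pi Set.univ
            (fun _ : ι => ((RingHom.ker e₂ ⊓ RingHom.ker e₄ : Ideal T) : Submodule T T))) ↔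
      (RingHom.ker e₃ ⊓ RingHom.ker e₄) ⊔ (RingHom.ker e₂ ⊓ RingHom.ker e₄) = RingHom.ker e₄ := by
  rw [pi_const_sup_eq, pi_const_saturated_iff]
  refine saturated_iff_eq_of_le p _ _ (sup_le inf_le_right inf_le_right) ?_ ?_
  · intro t ht
    exact hsat₄ t (by simpa [smul_eq_mul] using ht)
  · intro t ht
    obtain ⟨n, hn⟩ := hfin t ht
    exact ⟨n, by simpa [smul_eq_mul] using hn⟩

/-- **(K) ⟹ T-V54 for the free module (memo V58, Proposition V58 with F1).** If `η ∈ A_{oo∪Z}`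
(`η = U_{ℓ₁}² − 1` kills every `ℓ₁`-new component), every `t ∈ A_{oo∪Z∪W}` satisfies
`t − η·a ∈ A_{oo∪W∪W′} = ker e₂` for some `a` (the key identity (K) on the `ℓ₂`-new quotient:
`X4/LevelRaisingCongruenceOfOldSupported`), and `ker e₄` is `p`-saturated in `T`, then
`O₁ ⊔ O₂ = (ker e₃ ⊓ ker e₄)^ι ⊔ (ker e₂ ⊓ ker e₄)^ι` is `p`-saturated in `ι → T`.
[cite: Ribet1990, §3, Thm. 5.2] [cite: Diamond1995RefinedSerre, §§3–4] -/
theorem twoPrimeSaturated_of_levelRaising {ι : Type*}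
    (e₂ : T →+* R₂) (e₃ : T →+* R₃) (e₄ : T →+* R₄) (p η : T)
    (hsat₄ : ∀ t : T, p * t ∈ RingHom.ker e₄ → t ∈ RingHom.ker e₄)
    (hη : η ∈ RingHom.ker e₃ ⊓ RingHom.ker e₄)
    (hK : ∀ t ∈ RingHom.ker e₄, ∃ a : T, t - η * a ∈ RingHom.ker e₂) :
    ∀ x : ι → T,
        p • x ∈ Submodule.pi Set.univ
            (fun _ : ι => ((RingHom.ker e₃ ⊓ RingHom.ker e₄ : Ideal T) : Submodule T T)) ⊔
          Submodule.pi Set.univ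
            (fun _ : ι => ((RingHom.ker e₂ ⊓ RingHom.ker e₄ : Ideal T) : Submodule T T)) →
        x ∈ Submodule.pi Set.univ
            (fun _ : ι => ((RingHom.ker e₃ ⊓ RingHom.ker e₄ : Ideal T) : Submodule T T)) ⊔
          Submodule.pi Set.univ
            (fun _ : ι => ((RingHom.ker e₂ ⊓ RingHom.ker e₄ : Ideal T) : Submodule T T)) := by
  -- (R) from (K): K107
  have hR : (RingHom.ker e₃ ⊓ RingHom.ker e₄) ⊔ (RingHom.ker e₂ ⊓ RingHom.ker e₄) =
      RingHom.ker e₄ :=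
    supported_sup_eq_of_levelRaising (RingHom.ker e₃ ⊓ RingHom.ker e₄)
      (RingHom.ker e₂ ⊓ RingHom.ker e₄) (RingHom.ker e₄) (RingHom.ker e₂) η inf_le_right
      inf_le_right (fun t ht => ⟨ht.2, ht.1⟩) hη hK
  rw [pi_const_sup_eq, hR]
  exact pi_const_saturated_of_saturated p (RingHom.ker e₄) hsat₄

end StepOne

/-! ## Appendix (second landing, gen 41 — K121-2): PROPOSITION V58 IN KERNEL FORM

The V58 template as ONE implication, on the D-side data of K105/K106 (Brandt normalisation): `R` = the
Hecke algebra of `D_{ℓ₂∞}` at Eichler level `M₀`, localised ((MO^D₀): old plane `𝕏_{M₀}² = Fin 2 → R`;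
Ribet 1990 Thm 6.4 at `p`-free level with `ℓ₂ ≢ 1 (mod p)`, memo V72); `H′ = 𝕏_{M₀ℓ₁,𝔪₂}`;
`i = (α^*, β^*)`, `idag = δ = (α_*, β_*)`, `δ ∘ i = !![T_ℓ, ℓ+1; ℓ+1, T_ℓ]` [Ribet 1990 pp. 454–455];
`δ` SURJECTIVE [Ribet 1990 Thm 3.15]; `T = 𝕋(N)_{𝔪₂}` acts by `act` with adjoint `(e₂ t)ᵀ` [perfect
Hecke-bilinear pairings: Ribet 1990 Thm 3.12, `p ∤ w_e`], `e₂ : T →+* M₂(R)` the action on the old plane,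
`e₂(U_{ℓ₁}) = 𝒰 = !![0, −1; ℓ, T_ℓ]`, `hpoly`/`hlift`: `e₂(T) = R[𝒰]` (Appendix 2 discharges `hpoly` and
reduces `hlift` to `R·1 ⊆ e₂(T)`); `e₄` = type `W′` with `e₄ t = 0 ⟹ t·H′ ⊆ i(R²)` [`ℓ₁`-old saturation on
the D side]; `e₃` = type `W`, entering through `η = U² − 1 ∈ ker e₃ ⊓ ker e₄` [`a_{ℓ₁} = ±1` on `ℓ₁`-new
forms]; (MO_N) = the model `ι → T`; `ker e₂` = operators vanishing on the `Z`-components [Eichler/JL,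
Ribet 1990 Thm 3.10]. NOTHING in this list is proved here. -/

section KernelFormOfV58

open Matrix

variable {T R R₃ R₄ : Type*} [CommRing T] [CommRing R] [CommRing R₃] [CommRing R₄]
variable {H' : Type*} [AddCommGroup H']

/-- Polynomials of degree `≤ 1` in `𝒰` commute with `𝒰² − 1`. -/
theorem smul_one_add_smul_mul_sq_sub_one_comm (𝒰 : Matrix (Fin 2) (Fin 2) R) (c d : R) :
    (c • (1 : Matrix (Fin 2) (Fin 2) R) + d • 𝒰) * (𝒰 * 𝒰 - 1) =
      (𝒰 * 𝒰 - 1) * (c • (1 : Matrix (Fin 2) (Fin 2) R) + d • 𝒰) := by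
  have h𝒰 : Commute 𝒰 (𝒰 * 𝒰 - 1) :=
    ((Commute.refl 𝒰).mul_right (Commute.refl 𝒰)).sub_right (Commute.one_right 𝒰)
  have h1 : Commute (c • (1 : Matrix (Fin 2) (Fin 2) R)) (𝒰 * 𝒰 - 1) :=
    (Commute.one_left _).smul_left c
  have h2 : Commute (d • 𝒰) (𝒰 * 𝒰 - 1) := h𝒰.smul_left d
  exact (h1.add_left h2).eq

/-- **The key identity (K) from the Brandt-module data** (K106 + the lift): every `t` killing the
`ℓ₁`-new `D`-forms (`e₄ t = 0`) satisfies `t − η·a ∈ ker e₂` for some `a ∈ T`, `η = U² − 1` — the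
hypothesis `hK` of K107 / `twoPrimeSaturated_of_levelRaising`.
[cite: Ribet1990, §3, Thm. 5.2] [cite: Diamond1995RefinedSerre, §§3–4] -/
theorem keyIdentity_of_brandtData (Tl ℓ : R) (e₂ : T →+* Matrix (Fin 2) (Fin 2) R) (e₄ : T →+* R₄)
    (U : T) (hU : e₂ U = !![(0 : R), -1; ℓ, Tl])
    (act : T → (H' →+ H')) (i : (Fin 2 → R) →+ H') (idag : H' →+ (Fin 2 → R))
    (hu : ∀ v, idag (i v) = (!![Tl, ℓ + 1; ℓ + 1, Tl] : Matrix (Fin 2) (Fin 2) R).mulVec v)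
    (hsurj : Function.Surjective idag)
    (hadj : ∀ t h, idag (act t h) = (e₂ t).transpose.mulVec (idag h))
    (hW' : ∀ t, e₄ t = 0 → ∀ h, ∃ v, act t h = i v)
    (hpoly : ∀ t, ∃ a b : R, e₂ t = a • (1 : Matrix (Fin 2) (Fin 2) R) + b • !![(0 : R), -1; ℓ, Tl])
    (hlift : ∀ c d : R, ∃ a : T,
      e₂ a = c • (1 : Matrix (Fin 2) (Fin 2) R) + d • !![(0 : R), -1; ℓ, Tl]) :
    ∀ t ∈ RingHom.ker e₄, ∃ a : T, t - (U * U - 1) * a ∈ RingHom.ker e₂ := by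
  intro t ht
  rw [RingHom.mem_ker] at ht
  obtain ⟨a, b, hab⟩ := hpoly t
  have hact : ((e₂ t).transpose).transpose =
      a • (1 : Matrix (Fin 2) (Fin 2) R) + b • !![(0 : R), -1; ℓ, Tl] := by
    rw [Matrix.transpose_transpose, hab]
  obtain ⟨c, d, hcd⟩ := oldSupported_action_mem_etaIdeal_brandt Tl ℓ a b i idag (act t)
    (e₂ t).transpose hu (hadj t) (hW' t ht) hsurj hact
  obtain ⟨a', ha'⟩ := hlift c d
  refine ⟨a', ?_⟩
  rw [RingHom.mem_ker, map_sub, hab, hcd, map_mul, ha', map_sub, map_one, map_mul, hU,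
    smul_one_add_smul_mul_sq_sub_one_comm, sub_self]

/-- **PROPOSITION V58, KERNEL FORM** (memo V58 with F1; memo V72 §1). From the Brandt-module data of
`keyIdentity_of_brandtData` (Gram matrix `δ∘i = u`, `δ` surjective, adjoints w.r.t. `T`-bilinear
pairings, `ℓ₁`-old saturation on the `D`-side, `e₂(T) = R[𝒰]`), `η = U² − 1` killing the `ℓ₁`-new
types `W, W′`, and `ker e₄` `p`-saturated: in the multiplicity-one model `ι → T` the two-prime old
lattice `O₁ ⊔ O₂ = (ker e₃ ⊓ ker e₄)^ι ⊔ (ker e₂ ⊓ ker e₄)^ι` is `p`-SATURATED — T-V54(𝔪₂).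
[cite: Ribet1990, §3, Thm. 5.2] [cite: Wiles1995, Thm. 2.1] [cite: Diamond1995RefinedSerre, §§3–4] -/
theorem twoPrimeSaturated_of_brandtData {ι : Type*} (Tl ℓ : R)
    (e₂ : T →+* Matrix (Fin 2) (Fin 2) R) (e₃ : T →+* R₃) (e₄ : T →+* R₄) (p U : T)
    (hU : e₂ U = !![(0 : R), -1; ℓ, Tl])
    (act : T → (H' →+ H')) (i : (Fin 2 → R) →+ H') (idag : H' →+ (Fin 2 → R))
    (hu : ∀ v, idag (i v) = (!![Tl, ℓ + 1; ℓ + 1, Tl] : Matrix (Fin 2) (Fin 2) R).mulVec v)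
    (hsurj : Function.Surjective idag)
    (hadj : ∀ t h, idag (act t h) = (e₂ t).transpose.mulVec (idag h))
    (hW' : ∀ t, e₄ t = 0 → ∀ h, ∃ v, act t h = i v)
    (hpoly : ∀ t, ∃ a b : R, e₂ t = a • (1 : Matrix (Fin 2) (Fin 2) R) + b • !![(0 : R), -1; ℓ, Tl])
    (hlift : ∀ c d : R, ∃ a : T,
      e₂ a = c • (1 : Matrix (Fin 2) (Fin 2) R) + d • !![(0 : R), -1; ℓ, Tl])
    (hη₃ : e₃ (U * U - 1) = 0) (hη₄ : e₄ (U * U - 1) = 0)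
    (hsat₄ : ∀ t : T, p * t ∈ RingHom.ker e₄ → t ∈ RingHom.ker e₄) :
    ∀ x : ι → T,
        p • x ∈ Submodule.pi Set.univ
            (fun _ : ι => ((RingHom.ker e₃ ⊓ RingHom.ker e₄ : Ideal T) : Submodule T T)) ⊔
          Submodule.pi Set.univ
            (fun _ : ι => ((RingHom.ker e₂ ⊓ RingHom.ker e₄ : Ideal T) : Submodule T T)) →
        x ∈ Submodule.pi Set.univ
            (fun _ : ι => ((RingHom.ker e₃ ⊓ RingHom.ker e₄ : Ideal T) : Submodule T T)) ⊔
          Submodule.pi Set.univ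
            (fun _ : ι => ((RingHom.ker e₂ ⊓ RingHom.ker e₄ : Ideal T) : Submodule T T)) := by
  have hK := keyIdentity_of_brandtData Tl ℓ e₂ e₄ U hU act i idag hu hsurj hadj hW' hpoly hlift
  -- pass to the commutative quotient `T ⧸ ker e₂`, which has the same kernel
  have hker : RingHom.ker (Ideal.Quotient.mk (RingHom.ker e₂)) = RingHom.ker e₂ := Ideal.mk_ker
  have hη : U * U - 1 ∈ RingHom.ker e₃ ⊓ RingHom.ker e₄ :=
    ⟨by simpa [RingHom.mem_ker] using hη₃, by simpa [RingHom.mem_ker] using hη₄⟩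
  have h := twoPrimeSaturated_of_levelRaising (ι := ι) (Ideal.Quotient.mk (RingHom.ker e₂)) e₃ e₄
    p (U * U - 1) hsat₄ hη (by rw [hker]; exact hK)
  rw [hker] at h
  exact h

end KernelFormOfV58

/-! ## Appendix 2 (third landing, gen 41 — K121-3): `hpoly` DISCHARGED (the centralizer of the companion
matrix `𝒰` in `M₂(R)` is `R·1 + R·𝒰`, and `T` is commutative), `hlift` REDUCED to `hscalar : R·1 ⊆ e₂(T)`
(completeness of the anemic Hecke algebra, memo V58 P3): `twoPrimeSaturated_of_brandtData'`. -/

section KernelFormOfV58Discharged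

open Matrix

variable {T R R₃ R₄ : Type*} [CommRing T] [CommRing R] [CommRing R₃] [CommRing R₄]
variable {H' : Type*} [AddCommGroup H']

/-- **The centralizer of the Brandt companion matrix is `R[𝒰]`:** a `2 × 2` matrix commuting with
`𝒰 = !![0, −1; ℓ, T_ℓ]` is `a·1 + b·𝒰` (read off from its first row). [cite: Ribet1990, §3] -/
theorem exists_eq_smul_one_add_smul_of_commute_companion (Tl ℓ : R) (A : Matrix (Fin 2) (Fin 2) R)
    (hA : A * !![(0 : R), -1; ℓ, Tl] = !![(0 : R), -1; ℓ, Tl] * A) :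
    ∃ a b : R, A = a • (1 : Matrix (Fin 2) (Fin 2) R) + b • !![(0 : R), -1; ℓ, Tl] := by
  have h00 := congrFun (congrFun hA 0) 0
  have h01 := congrFun (congrFun hA 0) 1
  simp [Matrix.mul_apply, Fin.sum_univ_two] at h00 h01
  refine ⟨A 0 0, -(A 0 1), ?_⟩
  ext i j
  fin_cases i <;> fin_cases j <;> simp
  · linear_combination h00
  · linear_combination h01

/-- `hpoly` discharged: for a ring homomorphism `e₂` out of a COMMUTATIVE ring with `e₂ U = 𝒰`, every
`e₂ t` lies in `R·1 + R·𝒰`. -/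
theorem action_eq_smul_one_add_smul_companion (Tl ℓ : R) (e₂ : T →+* Matrix (Fin 2) (Fin 2) R)
    (U : T) (hU : e₂ U = !![(0 : R), -1; ℓ, Tl]) (t : T) :
    ∃ a b : R, e₂ t = a • (1 : Matrix (Fin 2) (Fin 2) R) + b • !![(0 : R), -1; ℓ, Tl] := by
  apply exists_eq_smul_one_add_smul_of_commute_companion
  rw [← hU, ← map_mul, ← map_mul, mul_comm]

/-- `hlift` from scalars: if `R·1 ⊆ e₂(T)` then `R·1 + R·𝒰 ⊆ e₂(T)`. -/
theorem exists_action_eq_of_scalar_lift (Tl ℓ : R) (e₂ : T →+* Matrix (Fin 2) (Fin 2) R) (U : T)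
    (hU : e₂ U = !![(0 : R), -1; ℓ, Tl])
    (hscalar : ∀ c : R, ∃ a : T, e₂ a = c • (1 : Matrix (Fin 2) (Fin 2) R)) (c d : R) :
    ∃ a : T, e₂ a = c • (1 : Matrix (Fin 2) (Fin 2) R) + d • !![(0 : R), -1; ℓ, Tl] := by
  obtain ⟨a₁, ha₁⟩ := hscalar c
  obtain ⟨a₂, ha₂⟩ := hscalar d
  refine ⟨a₁ + a₂ * U, ?_⟩
  rw [map_add, map_mul, ha₁, ha₂, hU, smul_mul_assoc, one_mul]

/-- **PROPOSITION V58, KERNEL FORM (final displayed hypotheses)**: as `twoPrimeSaturated_of_brandtData`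
with `hpoly` dropped and `hlift` replaced by `hscalar : R·1 ⊆ e₂(T)`. Displayed inputs: Gram matrix
[Ribet 1990 pp. 454–455], `δ` surjective [Thm 3.15], adjoint = transpose [Thm 3.12 + `p ∤ w_e`], `ℓ₁`-old
saturation on the D side (`hW'`), `hscalar`, `η = U² − 1` kills `W, W′`, `ker e₄` `p`-saturated; model:
old plane `Fin 2 → R` [(MO^D₀), Thm 6.4], `H′ = ι → T` [(MO_N)], `O_i` type-supported [Ihara at `ℓ_i`].
[cite: Ribet1990, §3, Thm. 5.2] [cite: Wiles1995, Thm. 2.1] [cite: Diamond1995RefinedSerre, §§3–4] -/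
theorem twoPrimeSaturated_of_brandtData' {ι : Type*} (Tl ℓ : R)
    (e₂ : T →+* Matrix (Fin 2) (Fin 2) R) (e₃ : T →+* R₃) (e₄ : T →+* R₄) (p U : T)
    (hU : e₂ U = !![(0 : R), -1; ℓ, Tl])
    (act : T → (H' →+ H')) (i : (Fin 2 → R) →+ H') (idag : H' →+ (Fin 2 → R))
    (hu : ∀ v, idag (i v) = (!![Tl, ℓ + 1; ℓ + 1, Tl] : Matrix (Fin 2) (Fin 2) R).mulVec v)
    (hsurj : Function.Surjective idag)
    (hadj : ∀ t h, idag (act t h) = (e₂ t).transpose.mulVec (idag h))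
    (hW' : ∀ t, e₄ t = 0 → ∀ h, ∃ v, act t h = i v)
    (hscalar : ∀ c : R, ∃ a : T, e₂ a = c • (1 : Matrix (Fin 2) (Fin 2) R))
    (hη₃ : e₃ (U * U - 1) = 0) (hη₄ : e₄ (U * U - 1) = 0)
    (hsat₄ : ∀ t : T, p * t ∈ RingHom.ker e₄ → t ∈ RingHom.ker e₄) :
    ∀ x : ι → T,
        p • x ∈ Submodule.pi Set.univ
            (fun _ : ι => ((RingHom.ker e₃ ⊓ RingHom.ker e₄ : Ideal T) : Submodule T T)) ⊔
          Submodule.pi Set.univ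
            (fun _ : ι => ((RingHom.ker e₂ ⊓ RingHom.ker e₄ : Ideal T) : Submodule T T)) →
        x ∈ Submodule.pi Set.univ
            (fun _ : ι => ((RingHom.ker e₃ ⊓ RingHom.ker e₄ : Ideal T) : Submodule T T)) ⊔
          Submodule.pi Set.univ
            (fun _ : ι => ((RingHom.ker e₂ ⊓ RingHom.ker e₄ : Ideal T) : Submodule T T)) :=
  twoPrimeSaturated_of_brandtData Tl ℓ e₂ e₃ e₄ p U hU act i idag hu hsurj hadj hW'
    (action_eq_smul_one_add_smul_companion Tl ℓ e₂ U hU)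
    (exists_action_eq_of_scalar_lift Tl ℓ e₂ U hU hscalar) hη₃ hη₄ hsat₄

end KernelFormOfV58Discharged

end Summit.BirchSwinnertonDyer.Rank1Residual.LevelLowering
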